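import Literature.AlgebraicGeometry.HodgeTheory.AbelianVarietyEndomorphismsHOne
import Literature.AlgebraicTopology.SingularHomology.CupProductExteriorH1
import Literature.AlgebraicTopology.SingularHomology.CompactGroupExteriorCohomology
import Literature.AlgebraicTopology.SingularHomology.BettiNumberBaseChange
import Literature.AlgebraicTopology.SingularHomology.UniversalCoefficientsField
import Literature.AlgebraicGeometry.Motives.AbelianVarietyFundamentalGroup
import Literature.AlgebraicGeometry.Motives.AbelianVarietyTorsionPointsCountProofs
import Literature.AlgebraicGeometry.Motives.AbelianVarietyProjectiveChart
import Summits.HodgeConjecture.HodgeConjecture.Theorems.WeilTenfoldsSqrtMinus11.Negative.EigenvalueSeparation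
import HarnessLib

/-!
# Crux `HeckePrymAnchors` (stmt-HodgeConjecture-14496), line `Sketch` · stub U `stub_upgrade`:
# the single-operator Weil plane lies in the strong Weil plane (`p` prime, `p ≠ 3`)

Route `HeckePrymWeil`. The crux types the Weil plane of a `√-p` abelian `2k`-fold `(X, Φ)`,
`Φ ≫ Φ = -p`, WEAKLY, through the single operator `(𝟙 + Φ)^*` on `H^{2k}(X(ℂ); ℂ)`:
`Eig((𝟙 + Φ)^*, (1 + i√p)^{2k}) ⊔ Eig((𝟙 + Φ)^*, (1 - i√p)^{2k})`. The tree's anchor lemmas are typed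
STRONGLY, with `weilClassesOf X Φ k p = E₊ ⊔ E₋` (`HodgeTheory/WeilClasses`: joint eigenclasses of ALL
`(x·𝟙 + y·Φ)^*`, `x y : ℕ`, for the characters `(x ± y i√p)^{2k}`). This file proves the inclusion
weak `≤` strong (`stub_upgrade`, the registered signature, unconditionally).

## Proof (van Geemen LNM 1594, proof of Thm. 6.12; eigenvalue separation)

Write `θ = i√p`, `V± = ker(Φ^* ∓ θ) ⊆ H¹(X(ℂ); ℂ)`. By the tree (`AbelianVarietyEndomorphismsHOne`):
`H¹ = V₊ ⊕ V₋` with `dim V₊ = dim V₋` (rationality of the trace of `Φ^*`), so both have dimension `2k`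
once `b₁ = 4k`; and `H^{2k} = ⋀^{2k} H¹` (`HasExteriorCohomologyH1`, the comparison map `wedgeToCup`).
In an eigenbasis `b` of `H¹` the wedge basis `b_S = ⌣_{i ∈ S} bᵢ` (`|S| = 2k`) diagonalises every
`(x·𝟙 + y·Φ)^*` with character `∏_{i ∈ S} (x + y λᵢ)` (`map_cupPowOne`, `(x·𝟙 + y·Φ)^* = x + yΦ^*` on
`H¹`); in particular `(𝟙 + Φ)^* b_S = (1 + θ)^a (1 - θ)^b b_S`, `a + b = 2k`, `b = #{i ∈ S : λᵢ = -θ}`.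
For a PRIME `p ≠ 3`, `(1 + θ)^a (1 - θ)^b ≠ (1 + θ)^{2k}` unless `b = 0` (the tree's
`weil_mixed_ne_plus`: `(1 - θ)/(1 + θ)` is not a root of unity; it IS at `p = 3`), so an eigenvector of
`(𝟙 + Φ)^*` for `(1 + θ)^{2k}` has its `b_S`-coordinates supported on the single index `S₀ = {λᵢ = θ}`
(`forall_apply_eq_smul_iff_mem_span_singleton`), i.e. is a multiple of `b_{S₀}`, which is a joint
eigenclass of all `(x·𝟙 + y·Φ)^*` with character `(x + yθ)^{2k}`: it lies in `E₊`. Same for `E₋`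
(`weil_mixed_ne_minus`).

The two inputs `b₁(X(ℂ)) = 2 dim X` and `H•(X(ℂ); ℂ) = ⋀• H¹` — the body of the tree's named fact
`Motives.abelianVarietyCohomologyExteriorH1` — are PROVED in the tree (Hopf's theorem for the compact
connected group manifold `X(ℂ)`, `hasExteriorCohomologyH1_of_group`; `b₁` from the count of torsion
points, `finrank_bettiCohomology_one_eq_of_natCard_torsionPoints`); they are re-assembled here
(`up_exteriorH1`, three lines, the same assembly as the tree's `abelianVarietyCohomologyExteriorH1_holds`
of `Motives/AbelianVarietyCohomologyExteriorH1`, whose rebuilt module was not yet importable at the time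
of writing) from those importable theorems, so `stub_upgrade` is unconditional. The conditional form
`stub_upgrade_of_exteriorH1` (hypothesis = verbatim body of the named fact) is kept as the interface.

## References

* [vanGeemen1994HodgeAV] B. van Geemen, An introduction to the Hodge conjecture for abelian
  varieties, LNM 1594 (1994), 4.9, proof of Lemma 5.2 (6), proof of Thm. 6.12.
* [LangeBirkenhake1992] H. Lange, Ch. Birkenhake, Complex Abelian Varieties (1992), Lemma 1.1.17,
  Exercise 1.1.6 (7)–(8), Prop. 1.1.9.
* [MumfordAV1970] D. Mumford, Abelian Varieties (1970), §1 (3)–(4).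
-/

noncomputable section
-- every declaration of this problem lives in Summit.HodgeConjecture.HodgeConjecture.… (summit = sub-problem)
set_option linter.dupNamespace false

open CategoryTheory AlgebraicGeometry
open Literature.AlgebraicGeometry

namespace Summit.HodgeConjecture.HodgeConjecture.Theorems.HeckePrymWeilLine

open Literature.AlgebraicGeometry.Motives Literature.AlgebraicGeometry.HodgeTheory
open Literature.AlgebraicTopology.SingularHomology
open Summit.HodgeConjecture.HodgeConjecture.Theorems.WeilTenfoldsSqrtMinus11.Negative

/-! ### Eigenvalue separation for a product of signs -/

/-- If a family of eigenvalues `λᵢ ∈ {s, -s}` (`s ≠ 0`) contains `-s`, and the mixed products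
`(1 + s)ᵃ (1 - s)ᵇ`, `b ≥ 1`, `a + b = N`, all differ from `(1 + s)^N`, then
`∏ᵢ (1 + λᵢ) ≠ (1 + s)^N`. [folklore] -/
theorem up_prod_one_add_ne_pow {s : ℂ} (hs : s ≠ 0) {N : ℕ} (lam : Fin N → ℂ)
    (hlam : ∀ i, lam i = s ∨ lam i = -s) (hneg : ∃ i, lam i = -s)
    (hsep : ∀ a b : ℕ, a + b = N → 1 ≤ b → (1 + s) ^ a * (1 - s) ^ b ≠ (1 + s) ^ N) :
    (∏ i, (1 + lam i)) ≠ (1 + s) ^ N := by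
  classical
  set A := Finset.univ.filter fun i : Fin N => lam i = s with hA
  set Bn := Finset.univ.filter fun i : Fin N => ¬ lam i = s with hBn
  have hBpos : 1 ≤ Bn.card := by
    obtain ⟨i, hi⟩ := hneg
    refine Finset.card_pos.mpr ⟨i, ?_⟩
    rw [hBn, Finset.mem_filter]
    refine ⟨Finset.mem_univ _, fun h => hs ?_⟩
    have : (2 : ℂ) * s = 0 := by rw [two_mul]; nth_rewrite 1 [← h]; rw [hi, neg_add_cancel]
    exact (mul_eq_zero.mp this).resolve_left two_ne_zero
  have hcard : A.card + Bn.card = N := by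
    rw [hA, hBn, Finset.card_filter_add_card_filter_not, Finset.card_univ, Fintype.card_fin]
  rw [← Finset.prod_filter_mul_prod_filter_not Finset.univ (fun i : Fin N => lam i = s)]
  have h1 : ∏ i ∈ Finset.univ.filter (fun i : Fin N => lam i = s), (1 + lam i) =
      (1 + s) ^ A.card := by
    rw [Finset.prod_congr rfl (fun i hi => by rw [(Finset.mem_filter.mp hi).2]), Finset.prod_const]
  have h2 : ∏ i ∈ Finset.univ.filter (fun i : Fin N => ¬ lam i = s), (1 + lam i) =
      (1 - s) ^ Bn.card := by
    rw [Finset.prod_congr rfl (fun i hi => by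
      rw [((hlam i).resolve_left (Finset.mem_filter.mp hi).2), ← sub_eq_add_neg]), Finset.prod_const]
  rw [h1, h2]
  exact hsep _ _ hcard hBpos

/-! ### The single-operator eigenspace lies in the joint eigenclass line -/

/-- **`Eig((𝟙 + φ)^*, (1 + μ)²ⁿ) ≤ ` the joint `(x + yμ)²ⁿ`-eigenclasses**, `μ = ± i√d`, for
`φ ≫ φ = -d`, `d ≥ 1`, granted `H•(A(ℂ); ℂ) = ⋀• H¹` and `b₁ = 4n`, PROVIDED the mixed eigenvalues
`(1 + μ)ᵃ (1 - μ)ᵇ` (`b ≥ 1`, `a + b = 2n`) of `(𝟙 + φ)^* = ⋀²ⁿ(1 + φ^*|_{H¹})` differ from `(1 + μ)²ⁿ`.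
In an eigenbasis of `H¹ = V_μ ⊕ V_{-μ}` (each of dimension `2n`) the wedge basis of `H²ⁿ` diagonalises
`(𝟙 + φ)^*` with eigenvalue `∏_{i ∈ S} (1 + λᵢ)`, matched with `(1 + μ)²ⁿ` only by `S₀ = {λᵢ = μ}`;
and `b_{S₀}` is a joint eigenclass of all `(x·𝟙 + y·φ)^*` for `(x + yμ)²ⁿ`.
[cite: vanGeemen1994HodgeAV, proof of Thm. 6.12 and of Lemma 5.2 (6)] -/
theorem up_eigenspace_le_pullbackEigenclasses {A : AbelianVariety ℂ} {n d : ℕ}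
    (hΛ : HasExteriorCohomologyH1 ℂ (ComplexPoints A.X))
    (hb₁ : Module.finrank ℂ (complexBetti A.X 1) = 2 * (2 * n)) (hd : 0 < d) {φ : A ⟶ A}
    (hφ : φ ≫ φ = -(d • 𝟙 A)) {μ : ℂ}
    (hμ : μ = Complex.I * (Real.sqrt d : ℂ) ∨ μ = -(Complex.I * (Real.sqrt d : ℂ)))
    (hsep : ∀ a b : ℕ, a + b = 2 * n → 1 ≤ b → (1 + μ) ^ a * (1 - μ) ^ b ≠ (1 + μ) ^ (2 * n))
    {ev : ℂ} (hev : ev = (1 + μ) ^ (2 * n))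
    {χ : ℕ → ℕ → ℂ} (hχ : ∀ x y : ℕ, χ x y = ((x : ℂ) + (y : ℂ) * μ) ^ (2 * n)) :
    Module.End.eigenspace (complexBetti.map (𝟙 A + φ).hom.hom.hom (2 * n)).hom ev ≤
      pullbackEigenclasses A φ (2 * n) χ := by
  classical
  subst hev
  haveI := finite_complexBetti_abelianVariety A 1
  set T := (complexBetti.map φ.hom.hom.hom 1).hom with hT
  have hμ0 : μ ≠ 0 := by
    rcases hμ with rfl | rfl
    · exact I_mul_sqrt_ne_zero hd
    · exact neg_ne_zero.mpr (I_mul_sqrt_ne_zero hd)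
  -- `H¹ = V_μ ⊕ V_{-μ}`, both of dimension `2n` (adapted from `finrank_pullbackEigenclasses_pow_eq_one`)
  have hps : Module.finrank ℂ (Module.End.eigenspace T (Complex.I * (Real.sqrt d : ℂ))) = 2 * n := by
    have h := two_mul_finrank_eigenspace_eq hd hφ
    rw [hb₁] at h
    change 2 * Module.finrank ℂ (Module.End.eigenspace T (Complex.I * (Real.sqrt d : ℂ))) =
      2 * (2 * n) at h
    omega
  have hqs : Module.finrank ℂ (Module.End.eigenspace T (-(Complex.I * (Real.sqrt d : ℂ)))) = 2 * n := by
    have h := finrank_eigenspace_eq_finrank_eigenspace_neg hd hφ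
    change Module.finrank ℂ (Module.End.eigenspace T (Complex.I * (Real.sqrt d : ℂ))) =
      Module.finrank ℂ (Module.End.eigenspace T (-(Complex.I * (Real.sqrt d : ℂ)))) at h
    rw [← h, hps]
  have hcompl : IsCompl (Module.End.eigenspace T μ) (Module.End.eigenspace T (-μ)) := by
    rcases hμ with rfl | rfl
    · exact isCompl_eigenspace_eigenspace_neg hd hφ
    · rw [neg_neg]; exact (isCompl_eigenspace_eigenspace_neg hd hφ).symm
  have hp : Module.finrank ℂ (Module.End.eigenspace T μ) = 2 * n := by
    rcases hμ with rfl | rfl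
    · exact hps
    · exact hqs
  have hq : Module.finrank ℂ (Module.End.eigenspace T (-μ)) = 2 * n := by
    rcases hμ with rfl | rfl
    · exact hqs
    · rw [neg_neg]; exact hps
  -- an eigenbasis of `H¹`, the `μ`-vectors first
  let bp := Module.finBasisOfFinrankEq ℂ (Module.End.eigenspace T μ) hp
  let bm := Module.finBasisOfFinrankEq ℂ (Module.End.eigenspace T (-μ)) hq
  let b₀ : Module.Basis (Fin (2 * n) ⊕ Fin (2 * n)) ℂ (complexBetti A.X 1) :=
    (bp.prod bm).map (Submodule.prodEquivOfIsCompl _ _ hcompl)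
  let b : Module.Basis (Fin (2 * n + 2 * n)) ℂ (complexBetti A.X 1) := b₀.reindex finSumFinEquiv
  let lam : Fin (2 * n + 2 * n) → ℂ := fun i =>
    Sum.elim (fun _ => μ) (fun _ => -μ) (finSumFinEquiv.symm i)
  have hlam : ∀ i, lam i = μ ∨ lam i = -μ := fun i => by
    change Sum.elim (fun _ => μ) (fun _ => -μ) (finSumFinEquiv.symm i) = μ ∨
      Sum.elim (fun _ => μ) (fun _ => -μ) (finSumFinEquiv.symm i) = -μ
    rcases finSumFinEquiv.symm i with k | k
    · exact Or.inl rfl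
    · exact Or.inr rfl
  have hb_mem : ∀ i, b i ∈ Module.End.eigenspace T (lam i) := by
    intro i
    rw [Module.Basis.reindex_apply]
    change b₀ (finSumFinEquiv.symm i) ∈
      Module.End.eigenspace T (Sum.elim (fun _ => μ) (fun _ => -μ) (finSumFinEquiv.symm i))
    rcases finSumFinEquiv.symm i with k | k
    · simp only [Sum.elim_inl, b₀, Module.Basis.map_apply, Module.Basis.prod_apply, Function.comp_apply,
        LinearMap.inl_apply, Submodule.coe_prodEquivOfIsCompl', Submodule.coe_zero, add_zero]
      exact (bp k).2
    · simp only [Sum.elim_inr, b₀, Module.Basis.map_apply, Module.Basis.prod_apply, Function.comp_apply,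
        LinearMap.inr_apply, Submodule.coe_prodEquivOfIsCompl', Submodule.coe_zero, zero_add]
      exact (bm k).2
  -- the wedge basis of `H²ⁿ` and the action of the test endomorphisms on it
  let Bw : Module.Basis (Set.powersetCard (Fin (2 * n + 2 * n)) (2 * n)) ℂ (complexBetti A.X (2 * n)) :=
    (b.exteriorPower (2 * n)).map (hΛ.equiv (2 * n))
  have hBw : ∀ S, Bw S = cupPowOne ℂ (ComplexPoints A.X) (2 * n)
      (b ∘ (Set.powersetCard.ofFinEmbEquiv.symm S)) := by
    intro S
    change hΛ.equiv (2 * n) ((b.exteriorPower (2 * n)) S) = _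
    rw [exteriorPower.basis_apply, HasExteriorCohomologyH1.equiv_apply, exteriorPower.ιMulti_family,
      wedgeToCup_ιMulti]
  have hact : ∀ (x y : ℕ) (S : Set.powersetCard (Fin (2 * n + 2 * n)) (2 * n)),
      (complexBetti.map (x • 𝟙 A + y • φ).hom.hom.hom (2 * n)).hom (Bw S) =
        (∏ i : Fin (2 * n), ((x : ℂ) + (y : ℂ) * lam (Set.powersetCard.ofFinEmbEquiv.symm S i))) •
          Bw S := by
    intro x y S
    rw [hBw]
    change singularCohomology.map ℂ ℂ
      (AlgPoints.mapContinuous (L := ℂ) (x • 𝟙 A + y • φ).hom.hom.hom) (2 * n)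
        (cupPowOne ℂ _ (2 * n) _) = _
    rw [map_cupPowOne]
    have e : (fun i => singularCohomology.map ℂ ℂ
        (AlgPoints.mapContinuous (L := ℂ) (x • 𝟙 A + y • φ).hom.hom.hom) 1
          ((b ∘ (Set.powersetCard.ofFinEmbEquiv.symm S)) i)) =
        fun i => ((x : ℂ) + (y : ℂ) * lam (Set.powersetCard.ofFinEmbEquiv.symm S i)) •
          (b ∘ (Set.powersetCard.ofFinEmbEquiv.symm S)) i := by
      funext i
      exact complexBetti_map_nsmul_id_add_nsmul_one_of_mem_eigenspace (hb_mem _) x y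
    rw [e, MultilinearMap.map_smul_univ]
  -- the single operator `(𝟙 + φ)^* = (1·𝟙 + 1·φ)^*` on the wedge basis
  have e11 : ((1 : ℕ) • 𝟙 A + (1 : ℕ) • φ : A ⟶ A) = 𝟙 A + φ := by rw [one_smul, one_smul]
  have hact1 : ∀ (u : Unit) (S : Set.powersetCard (Fin (2 * n + 2 * n)) (2 * n)),
      (fun _ : Unit => (complexBetti.map (𝟙 A + φ).hom.hom.hom (2 * n)).hom) u (Bw S) =
        (fun (S : Set.powersetCard (Fin (2 * n + 2 * n)) (2 * n)) (_ : Unit) =>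
          ∏ i : Fin (2 * n), (1 + lam (Set.powersetCard.ofFinEmbEquiv.symm S i))) S u • Bw S := by
    intro _ S
    have h := hact 1 1 S
    rw [e11] at h
    change (complexBetti.map (𝟙 A + φ).hom.hom.hom (2 * n)).hom (Bw S) =
      (∏ i : Fin (2 * n), (1 + lam (Set.powersetCard.ofFinEmbEquiv.symm S i))) • Bw S
    rw [h]
    refine congrArg (· • Bw S) (Finset.prod_congr rfl fun i _ => ?_)
    rw [Nat.cast_one, one_mul]
  -- the distinguished index: the `2n` vectors of eigenvalue `μ`
  let S₀ : Set.powersetCard (Fin (2 * n + 2 * n)) (2 * n) :=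
    Set.powersetCard.ofFinEmbEquiv (Fin.castAddOrderEmb (2 * n))
  have hS₀ : ∀ i : Fin (2 * n + 2 * n), i ∈ S₀ ↔ ∃ k : Fin (2 * n), Fin.castAdd (2 * n) k = i := by
    intro i
    rw [Set.powersetCard.mem_ofFinEmbEquiv_iff_mem_range]
    rfl
  have hlam_pos : ∀ i, i ∈ S₀ → lam i = μ := by
    intro i hi
    obtain ⟨k, rfl⟩ := (hS₀ i).1 hi
    change Sum.elim (fun _ => μ) (fun _ => -μ) (finSumFinEquiv.symm (Fin.castAdd (2 * n) k)) = μ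
    rw [finSumFinEquiv_symm_apply_castAdd, Sum.elim_inl]
  have hlam_neg : ∀ i, i ∉ S₀ → lam i = -μ := by
    intro i hi
    change Sum.elim (fun _ => μ) (fun _ => -μ) (finSumFinEquiv.symm i) = -μ
    generalize hj : finSumFinEquiv.symm i = j
    rcases j with k | k
    · exfalso
      refine hi ((hS₀ i).2 ⟨k, ?_⟩)
      rw [← finSumFinEquiv_apply_left, ← hj, Equiv.apply_symm_apply]
    · rfl
  -- the eigenvalue `∏ (1 + λᵢ)` of `(𝟙 + φ)^*` is `(1 + μ)²ⁿ` only at `S₀` (eigenvalue separation)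
  have hχ1 : ∀ S : Set.powersetCard (Fin (2 * n + 2 * n)) (2 * n),
      ((fun (S : Set.powersetCard (Fin (2 * n + 2 * n)) (2 * n)) (_ : Unit) =>
          ∏ i : Fin (2 * n), (1 + lam (Set.powersetCard.ofFinEmbEquiv.symm S i))) S =
        fun _ : Unit => (1 + μ) ^ (2 * n)) ↔ S = S₀ := by
    intro S
    constructor
    · intro h
      by_contra hne
      obtain ⟨i, hiS, hiS₀⟩ := (Set.powersetCard.exists_mem_notMem_iff_ne S S₀).1 hne
      obtain ⟨k₀, hk₀⟩ : i ∈ Set.range (Set.powersetCard.ofFinEmbEquiv.symm S) :=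
        (Set.powersetCard.mem_range_ofFinEmbEquiv_symm_iff_mem S i).2 hiS
      have hneg : ∃ k, (lam ∘ Set.powersetCard.ofFinEmbEquiv.symm S) k = -μ :=
        ⟨k₀, by rw [Function.comp_apply, hk₀]; exact hlam_neg i hiS₀⟩
      exact up_prod_one_add_ne_pow hμ0 (lam ∘ Set.powersetCard.ofFinEmbEquiv.symm S)
        (fun k => hlam _) hneg hsep (congrFun h ())
    · rintro rfl
      funext
      change (∏ i : Fin (2 * n), (1 + lam (Set.powersetCard.ofFinEmbEquiv.symm S₀ i))) =
        (1 + μ) ^ (2 * n)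
      rw [Finset.prod_congr rfl (fun i _ => by
        rw [hlam_pos _ ((Set.powersetCard.mem_range_ofFinEmbEquiv_symm_iff_mem S₀ _).1 ⟨i, rfl⟩)]),
        Finset.prod_const, Finset.card_univ, Fintype.card_fin]
  -- an eigenvector of `(𝟙 + φ)^*` for `(1 + μ)²ⁿ` is a multiple of `Bw S₀` …
  intro c hc
  have hiff := forall_apply_eq_smul_iff_mem_span_singleton (P := Unit) Bw
    (fun _ => (complexBetti.map (𝟙 A + φ).hom.hom.hom (2 * n)).hom)
    (fun S _ => ∏ i : Fin (2 * n), (1 + lam (Set.powersetCard.ofFinEmbEquiv.symm S i)))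
    hact1 (fun _ => (1 + μ) ^ (2 * n)) S₀ hχ1 c
  obtain ⟨a, rfl⟩ := Submodule.mem_span_singleton.mp
    (hiff.1 fun _ => Module.End.mem_eigenspace_iff.mp hc)
  -- … and `Bw S₀` is a joint eigenclass of all `(x·𝟙 + y·φ)^*` for `(x + yμ)²ⁿ`
  refine Submodule.smul_mem _ a ?_
  rw [mem_pullbackEigenclasses_iff]
  intro x y
  change (complexBetti.map (x • 𝟙 A + y • φ).hom.hom.hom (2 * n)).hom (Bw S₀) = _
  rw [hact x y S₀, hχ x y]
  refine congrArg (· • Bw S₀) ?_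
  rw [Finset.prod_congr rfl (fun i _ => by
    rw [hlam_pos _ ((Set.powersetCard.mem_range_ofFinEmbEquiv_symm_iff_mem S₀ _).1 ⟨i, rfl⟩)]),
    Finset.prod_const, Finset.card_univ, Fintype.card_fin]

/-! ### `b₁ = 2 dim` and `H• = ⋀• H¹` for complex abelian varieties (the tree's proved theorems, assembled) -/

/-- **`b₁(A(ℂ); ℂ) = 2 dim A`**: `dim_ℂ H¹(A(ℂ); ℂ) = dim_ℚ H¹(A(ℂ); ℚ)` (universal coefficients over
a field: `finrank_singularCohomology_eq_bettiNumber_of_field`, `bettiNumber_eq_of_algebra`)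
`= 2 dim A` (the tree's `finrank_bettiCohomology_one_eq_of_natCard_torsionPoints` with
`natCard_torsionPoints_of_isAlgClosed_holds`, Mumford §1 (3) with §6 App. 3).
[cite: MumfordAV1970, §1 (3)] -/
theorem up_finrank_complexBetti_one (A : AbelianVariety ℂ) :
    Module.finrank ℂ (complexBetti A.X 1) = 2 * A.dim := by
  rw [← AbelianVariety.finrank_bettiCohomology_one_eq_of_natCard_torsionPoints A
    (AbelianVariety.natCard_torsionPoints_of_isAlgClosed_holds A ℂ)]
  change Module.finrank ℂ (singularCohomology ℂ ℂ (A.Points ℂ) 1) =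
    Module.finrank ℚ (singularCohomology ℚ ℚ (A.Points ℂ) 1)
  rw [finrank_singularCohomology_eq_bettiNumber_of_field,
    finrank_singularCohomology_eq_bettiNumber_of_field, bettiNumber_eq_of_algebra ℚ ℂ]

/-- **`b₁ = 2 dim` and `H•(A(ℂ); ℂ) = ⋀• H¹(A(ℂ); ℂ)` for every complex abelian variety** — the
verbatim body of the tree's named fact `Motives.abelianVarietyCohomologyExteriorH1`, PROVED from the
tree: `A(ℂ)` is a compact connected group `2 dim A`-manifold with `b₁ = 2 dim A`, so Hopf's theorem in
the tree's form `hasExteriorCohomologyH1_of_group` applies; finiteness is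
`finite_complexBetti_abelianVariety`. [cite: LangeBirkenhake1992, Lemma 1.1.17 and Exercise 1.1.6 (7)–(8)] -/
theorem up_exteriorH1 : ∀ A : AbelianVariety ℂ,
    Module.Finite ℂ (complexBetti A.X 1) ∧ Module.finrank ℂ (complexBetti A.X 1) = 2 * A.dim ∧
      HasExteriorCohomologyH1 ℂ (ComplexPoints A.X) := fun A => by
  letI := (AbelianVariety.isSmoothProjective_holds (A := A)).chartedSpace
  exact ⟨finite_complexBetti_abelianVariety A 1, up_finrank_complexBetti_one A,
    hasExteriorCohomologyH1_of_group ℂ (G := A.Points ℂ) (n := 2 * A.dim)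
      (up_finrank_complexBetti_one A).ge⟩

/-! ### The typing upgrade -/

/-- **Stub U, conditional form**: granted `b₁ = 2 dim` and `H• = ⋀• H¹` for complex abelian varieties
(the verbatim body of the named fact `Motives.abelianVarietyCohomologyExteriorH1`), for a prime
`p ≥ 7` (so `p ≠ 3`) the single-operator Weil plane `Eig((𝟙 + Φ)^*, (1 + i√p)^{2k}) ⊔
Eig((𝟙 + Φ)^*, (1 - i√p)^{2k})` of a `√-p` abelian `2k`-fold lies in the strong Weil plane
`weilClassesOf X Φ k p = E₊ ⊔ E₋` (eigenvalue separation `weil_mixed_ne_plus/minus` +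
`up_eigenspace_le_pullbackEigenclasses`). [cite: vanGeemen1994HodgeAV, proof of Thm. 6.12] -/
theorem stub_upgrade_of_exteriorH1 :
    (∀ A : AbelianVariety ℂ,
      Module.Finite ℂ (complexBetti A.X 1) ∧ Module.finrank ℂ (complexBetti A.X 1) = 2 * A.dim ∧
        HasExteriorCohomologyH1 ℂ (ComplexPoints A.X)) →
    ∀ p : ℕ, p.Prime → p % 4 = 3 → 7 ≤ p → ∀ (k : ℕ) (X : AbelianVariety ℂ) (Φ : X ⟶ X),
      X.dim = 2 * k → Φ ≫ Φ = -((p : ℤ) • 𝟙 X) →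
      Module.End.eigenspace (complexBetti.map (𝟙 X + Φ).hom.hom.hom (2 * k)).hom
            ((1 + Complex.I * (Real.sqrt (p : ℝ) : ℂ)) ^ (2 * k)) ⊔
          Module.End.eigenspace (complexBetti.map (𝟙 X + Φ).hom.hom.hom (2 * k)).hom
            ((1 - Complex.I * (Real.sqrt (p : ℝ) : ℂ)) ^ (2 * k)) ≤
        weilClassesOf X Φ k p := by
  intro hΛ p hp _ hp7 k X Φ hX hΦ
  have hp0 : 0 < p := hp.pos
  have hp3 : p ≠ 3 := by omega
  have hΦ' : Φ ≫ Φ = -(p • 𝟙 X) := by rw [hΦ, natCast_zsmul]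
  have hb : Module.finrank ℂ (complexBetti X.X 1) = 2 * (2 * k) := by rw [(hΛ X).2.1, hX]
  rw [weilClassesOf, weilClassesPlus, weilClassesMinus]
  refine sup_le_sup ?_ ?_
  · exact up_eigenspace_le_pullbackEigenclasses (hΛ X).2.2 hb hp0 hΦ' (Or.inl rfl)
      (fun a b hab hb1 => weil_mixed_ne_plus hp hp3 hab hb1) rfl
      (fun x y => by rw [mul_assoc])
  · refine up_eigenspace_le_pullbackEigenclasses (hΛ X).2.2 hb hp0 hΦ' (Or.inr rfl)
      (fun a b hab hb1 => ?_) (by rw [← sub_eq_add_neg]) (fun x y => by rw [mul_neg, mul_assoc, sub_eq_add_neg])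
    rw [← sub_eq_add_neg, sub_neg_eq_add, mul_comm]
    exact weil_mixed_ne_minus hp hp3 (by omega) hb1

/-- **Stub U — TYPING UPGRADE weak → strong** (registered signature): for a prime `p ≥ 7` the crux's
single-operator plane `Eig((𝟙 + Φ)^*, (1 ± i√p)^{2k})` of a `√-p` abelian `2k`-fold `(X, Φ)` lies in
the tree's strong Weil plane `weilClassesOf X Φ k p` (joint eigenclasses of every `x·𝟙 + y·Φ`):
`H^{2k} = ⋀^{2k}(V₊ ⊕ V₋)`, eigenvalue `(1 + θ)ᵃ (1 - θ)ᵇ` on `⋀ᵃ V₊ ⊗ ⋀ᵇ V₋`, and `(1 - θ)/(1 + θ)`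
is no root of unity for `p ≠ 3` (`weil_mixed_ne_plus/minus`). Unconditional: the `⋀• H¹` dictionary
is `up_exteriorH1`. [cite: vanGeemen1994HodgeAV, proof of Thm. 6.12] -/
theorem stub_upgrade :
    ∀ p : ℕ, p.Prime → p % 4 = 3 → 7 ≤ p → ∀ (k : ℕ) (X : AbelianVariety ℂ) (Φ : X ⟶ X),
      X.dim = 2 * k → Φ ≫ Φ = -((p : ℤ) • 𝟙 X) →
      Module.End.eigenspace (complexBetti.map (𝟙 X + Φ).hom.hom.hom (2 * k)).hom
            ((1 + Complex.I * (Real.sqrt (p : ℝ) : ℂ)) ^ (2 * k)) ⊔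
          Module.End.eigenspace (complexBetti.map (𝟙 X + Φ).hom.hom.hom (2 * k)).hom
            ((1 - Complex.I * (Real.sqrt (p : ℝ) : ℂ)) ^ (2 * k)) ≤
        weilClassesOf X Φ k p :=
  stub_upgrade_of_exteriorH1 up_exteriorH1

end Summit.HodgeConjecture.HodgeConjecture.Theorems.HeckePrymWeilLine

end
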